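import Summits.ResolutionOfSingularities.ResolutionOfSingularities.Theorems.WallFrames3
import Summits.ResolutionOfSingularities.ResolutionOfSingularities.Theorems.NearCutCompanion3
import Summits.ResolutionOfSingularities.ResolutionOfSingularities.Theorems.NearCutWalls2
import Summits.ResolutionOfSingularities.ResolutionOfSingularities.Theorems.ProximityCutArcLaw
import Summits.ResolutionOfSingularities.ResolutionOfSingularities.Theorems.MaxContactCutBoundaryLedger
import Summits.ResolutionOfSingularities.ResolutionOfSingularities.Theorems.MaxContactCutWallCut
import Summits.ResolutionOfSingularities.ResolutionOfSingularities.Theorems.PlanarGhostDescent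
import Literature.AlgebraicGeometry.Resolution.PointBlowupIFPGiraud
import Literature.AlgebraicGeometry.Resolution.AdicNoetherian
import HarnessLib

/-!
# WallFrames (4/17) — Kollár's wall descent in a polynomial frame; sections: Jets (cont.), Lineage

Verbatim slice of the farm-checked monolith `WallFrames.lean` of cell `decomp-res`, seat `decomp-res-lens-5`, g35
(sha256 7405a21d81d102a4…, monolith lines 826–1088); one namespace `Summit.ResolutionOfSingularities.ResolutionOfSingularities.Theorems.WallFrames` across the
slices, imports chained.  The monolith's module docstring (laws W1–W7, mechanism, novelty, honest placement) is
reproduced in slice 1; the main theorem `balancedWallPort_holds : WallCut.BalancedWallPort` (hypothesis-free) and the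
host-route corollary `ecBalancedWallPort_holds` (aside item 27368 of route MaxContactCut) are in slice 16/17.
-/

open MvPolynomial Finset
open scoped BigOperators
open Literature.AlgebraicGeometry.Resolution
open Literature.AlgebraicGeometry.Resolution.Hauser2010
open Literature.AlgebraicGeometry.Resolution.PointBlowup
open Literature.AlgebraicGeometry.Resolution.HauserPerlega2024

namespace Summit.ResolutionOfSingularities.ResolutionOfSingularities.Theorems.WallFrames

variable {σ : Type*} [Fintype σ] [DecidableEq σ] {K : Type*} [Field K]

section Jets

omit [Fintype σ] in
/-- **NEWTON'S IMPLICIT JETS.** `w(0) = 0`, `coeff_{e_v} w ≠ 0` ⇒ for every `D` a `v`-free `ζ ∈ 𝔪` with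
`w(y_v := ζ) ∈ 𝔪^{D+1}`. [new] -/
theorem exists_jet (v : σ) {w : MvPolynomial σ K} (hw0 : constantCoeff w = 0)
    (hw1 : coeff (Finsupp.single v 1) w ≠ 0) (D : ℕ) :
    ∃ ζ : MvPolynomial σ K, (∀ μ ∈ ζ.support, μ v = 0) ∧ (1 : ℕ∞) ≤ ordZero ζ ∧
      ((D + 1 : ℕ) : ℕ∞) ≤ ordZero (vsubst v ζ w) := by
  induction D with
  | zero =>
    have h0 : (1 : ℕ∞) ≤ ordZero (0 : MvPolynomial σ K) := by
      rw [ordZero_eq_top_iff.mpr rfl]; exact le_top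
    refine ⟨0, fun d hd => ?_, h0, ?_⟩
    · rw [MvPolynomial.support_zero] at hd; exact absurd hd (Finset.notMem_empty d)
    have h1 : (1 : ℕ∞) ≤ ordZero w := (one_le_ordZero_iff w).mpr hw0
    have := le_ordZero_vsubst (v := v) (ζ := 0) h0 w
    exact le_trans (by simpa using h1) this
  | succ D ih =>
    obtain ⟨ζ, hζ, hζ1, hζD⟩ := ih
    obtain ⟨Q, hQ⟩ := exists_factor v ζ w
    set lam := coeff (Finsupp.single v 1) w with hlam
    have hQ0 : constantCoeff Q = lam := constantCoeff_factor hζ hζ1 hQ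
    set r := vsubst v ζ w with hr
    have hrfree : (∀ μ ∈ r.support, μ v = 0) := varFree_vsubst hζ w
    set ρ := homogeneousComponent (D + 1) r with hρ
    set η : MvPolynomial σ K := C (-lam⁻¹) * ρ with hη
    have hηfree : (∀ μ ∈ η.support, μ v = 0) := varFree_mul (varFree_C v _) (varFree_homogeneousComponent hrfree _)
    have hηord : ((D + 1 : ℕ) : ℕ∞) ≤ ordZero η :=
      le_trans (le_ordZero_of_isHomogeneous (homogeneousComponent_isHomogeneous (D + 1) r)) (le_ordZero_mul_left _ _)
    have hη1 : (1 : ℕ∞) ≤ ordZero η := le_trans (by exact_mod_cast Nat.succ_pos D) hηord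
    have hζ'1 : (1 : ℕ∞) ≤ ordZero (ζ + η) := le_ordZero_add hζ1 hη1
    refine ⟨ζ + η, varFree_add hζ hηfree, hζ'1, ?_⟩
    -- apply the substitution `y_v := ζ + η` to the factorisation
    have hsub : vsubst v (ζ + η) w = vsubst v (ζ + η) Q * η + r := by
      conv_lhs => rw [hQ]
      rw [map_add, map_mul, map_sub, vsubst_X_self, vsubst_of_varFree _ hζ, vsubst_of_varFree _ hrfree]
      ring
    set Q' := vsubst v (ζ + η) Q with hQ'
    have hQ'0 : constantCoeff (Q' - C lam) = 0 := by
      rw [map_sub, constantCoeff_C, hQ', constantCoeff_vsubst hζ'1, hQ0, sub_self]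
    have hsplit : vsubst v (ζ + η) w = (Q' - C lam) * η + (r - ρ) := by
      rw [hsub, hη]
      have : C lam * (C (-lam⁻¹) * ρ) = -ρ := by
        rw [← mul_assoc, ← C_mul, mul_neg, mul_inv_cancel₀ hw1, C_neg, C_1]; ring
      linear_combination this
    rw [hsplit]
    refine le_ordZero_add ?_ (Hauser2010.succ_le_ordZero_sub_homogeneousComponent hζD)
    have h1 : (1 : ℕ∞) ≤ ordZero (Q' - C lam) := (one_le_ordZero_iff _).mpr hQ'0
    calc ((D + 1 + 1 : ℕ) : ℕ∞) = 1 + ((D + 1 : ℕ) : ℕ∞) := by push_cast; ring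
      _ ≤ ordZero (Q' - C lam) + ordZero η := add_le_add h1 hηord
      _ ≤ ordZero ((Q' - C lam) * η) := le_ordZero_mul _ _

omit [Fintype σ] in
/-- **UNIQUENESS OF JETS**: two `v`-free `ζ, ζ' ∈ 𝔪` with `w(y_v := ζ), w(y_v := ζ') ∈ 𝔪^{D+1}` agree modulo
`𝔪^{D+1}` (`coeff_{e_v} w ≠ 0`). [new] -/
theorem jet_unique {v : σ} {w ζ ζ' : MvPolynomial σ K} (hw1 : coeff (Finsupp.single v 1) w ≠ 0)
    (hζ : (∀ μ ∈ ζ.support, μ v = 0)) (hζ1 : (1 : ℕ∞) ≤ ordZero ζ) (hζ'1 : (1 : ℕ∞) ≤ ordZero ζ') {D : ℕ}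
    (hD : ((D + 1 : ℕ) : ℕ∞) ≤ ordZero (vsubst v ζ w)) (hD' : ((D + 1 : ℕ) : ℕ∞) ≤ ordZero (vsubst v ζ' w)) :
    ((D + 1 : ℕ) : ℕ∞) ≤ ordZero (ζ' - ζ) := by
  obtain ⟨Q, hQ⟩ := exists_factor v ζ w
  have hQ0 : constantCoeff Q = coeff (Finsupp.single v 1) w := constantCoeff_factor hζ hζ1 hQ
  have hsub : vsubst v ζ' w = vsubst v ζ' Q * (ζ' - ζ) + vsubst v ζ w := by
    conv_lhs => rw [hQ]
    rw [map_add, map_mul, map_sub, vsubst_X_self, vsubst_of_varFree _ hζ, vsubst_of_varFree _ (varFree_vsubst hζ w)]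
  have hord0 : ordZero (vsubst v ζ' Q) = 0 := by
    rw [ordZero_eq_zero_iff, constantCoeff_vsubst hζ'1, hQ0]; exact hw1
  have hdiff : ((D + 1 : ℕ) : ℕ∞) ≤ ordZero (vsubst v ζ' Q * (ζ' - ζ)) := by
    have : vsubst v ζ' Q * (ζ' - ζ) = vsubst v ζ' w - vsubst v ζ w := by rw [hsub]; ring
    rw [this]; exact le_ordZero_sub hD' hD
  rwa [ordZero_mul, hord0, zero_add] at hdiff

end Jets

/-! ## §5 Giraud persistence of the Hasse max-contact lineage (every characteristic, any charts)

`hasseSpan n G = ⟨D^{(M)} G : |M| ≤ n⟩`.  LEVEL TRANSPORT (char-free form of the Literature's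
`chartTransform_mem_span_of_mem_span`, assembled from Giraud's lemma in the chart `chartTransform_hasseDeriv_mem_span`):
`x ∈ hasseSpan n G`, `n ≤ s ≤ ord₀ G` ⇒ `chartTransform (s − n) j x ∈ hasseSpan n (chartTransform s j G)`.  Hence the
LINEAGE `h_{n+1} = translate b_n (chartTransform 1 j_n h_n)` of any `h_0 ∈ hasseSpan (s−1) G_0` along an equimultiple
chain stays in `hasseSpan (s−1) G_n ⊆ 𝔪`: every later centre lies on the strict transform of `{h_0 = 0}` — for
lost-wall and free-chart moves alike.  The transversal linear coefficients of `h` are carried verbatim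
(`coeff_single_translate_chartTransform_one`), and the RECENTRING LAW turns "centre on the lineage" into `ζ' ∈ 𝔪`. -/

section Lineage

/-- The ideal spanned by the Hasse–Schmidt derivatives of order `≤ n` of `G`. DEFINITION (support). -/
noncomputable def hasseSpan (n : ℕ) (G : MvPolynomial σ K) : Ideal (MvPolynomial σ K) :=
  Ideal.span ((fun M => hasseDeriv K M G) '' {M | M.degree ≤ n})

omit [Fintype σ] in
/-- `hasseSpan_le_idealOfVars_pow`: WallFrames (lens-5 g35) computation rule; docstring added by the writer (lint.docstring) [folklore] -/
theorem hasseSpan_le_idealOfVars_pow {s : ℕ} {G : MvPolynomial σ K} (hG : (s : ℕ∞) ≤ ordZero G) (n : ℕ) :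
    hasseSpan n G ≤ idealOfVars σ K ^ (s - n) :=
  span_hasseDeriv_le_idealOfVars_pow hG fun _ hM => hM

omit [Fintype σ] [DecidableEq σ] in
/-- `hasseDeriv_mem_hasseSpan`: WallFrames (lens-5 g35) computation rule; docstring added by the writer (lint.docstring) [folklore] -/
theorem hasseDeriv_mem_hasseSpan {n : ℕ} {M : σ →₀ ℕ} (hM : M.degree ≤ n) (G : MvPolynomial σ K) :
    hasseDeriv K M G ∈ hasseSpan n G :=
  Ideal.subset_span ⟨M, hM, rfl⟩

/-- The total transform `θ_j : y_i ↦ y_j y_i (i ≠ j), y_j ↦ y_j`. DEFINITION (support). -/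
noncomputable def total (j : σ) : MvPolynomial σ K →ₐ[K] MvPolynomial σ K :=
  aeval fun i => if i = j then X j else X j * X i

omit [Fintype σ] in
/-- `X_pow_mul_chartTransform'`: WallFrames (lens-5 g35) computation rule; docstring added by the writer (lint.docstring) [folklore] -/
theorem X_pow_mul_chartTransform' (j : σ) {a : ℕ} {P : MvPolynomial σ K} (hP : (a : ℕ∞) ≤ ordZero P) :
    X j ^ a * chartTransform a j P = total j P :=
  X_pow_mul_chartTransform j hP

omit [Fintype σ] in
/-- **LEVEL TRANSPORT OF THE HASSE SPAN** (char-free Giraud): `x ∈ hasseSpan n G`, `n ≤ s ≤ ord₀ G` ⇒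
`chartTransform (s − n) j x ∈ hasseSpan n (chartTransform s j G)`.
[cite: Giraud1975, Lemme 4.2 p.III-29] [cite: CossartJannsenSaito2020, Thm 2.13 p.29] -/
theorem chartTransform_mem_hasseSpan (j : σ) {s n : ℕ} (hns : n ≤ s) {G x : MvPolynomial σ K}
    (hG : (s : ℕ∞) ≤ ordZero G) (hx : x ∈ hasseSpan n G) :
    chartTransform (s - n) j x ∈ hasseSpan n (chartTransform s j G) := by
  classical
  let J : Ideal (MvPolynomial σ K) :=
    Ideal.comap (total (K := K) j).toRingHom (Ideal.span {X j ^ (s - n)} * hasseSpan n (chartTransform s j G))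
  have hgen : hasseSpan n G ≤ J := by
    rw [hasseSpan, Ideal.span_le]
    rintro _ ⟨M, hM, rfl⟩
    simp only [Set.mem_setOf_eq] at hM
    show total j (hasseDeriv K M G) ∈ Ideal.span {X j ^ (s - n)} * hasseSpan n (chartTransform s j G)
    have hordM : ((s - M.degree : ℕ) : ℕ∞) ≤ ordZero (hasseDeriv K M G) := natCast_sub_le_ordZero_hasseDeriv M hG
    rw [← X_pow_mul_chartTransform' j hordM]
    have giraud := chartTransform_hasseDeriv_mem_span j M (le_trans hM hns) hG
    have hsub : Ideal.span ((fun M' => hasseDeriv K M' (chartTransform s j G)) ''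
        {M' | (M.erase j).degree ≤ M'.degree ∧ M'.degree ≤ M.degree}) ≤ hasseSpan n (chartTransform s j G) :=
      Ideal.span_mono (Set.image_mono fun M' hM' => le_trans hM'.2 hM)
    have hsplit : (X j : MvPolynomial σ K) ^ (s - M.degree) * chartTransform (s - M.degree) j (hasseDeriv K M G) =
        X j ^ (s - n) * (X j ^ (n - M.degree) * chartTransform (s - M.degree) j (hasseDeriv K M G)) := by
      rw [← mul_assoc, ← pow_add]
      congr 2
      omega
    rw [hsplit]
    exact Ideal.mul_mem_mul (Ideal.mem_span_singleton_self _) (Ideal.mul_mem_left _ _ (hsub giraud))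
  have hxJ : total j x ∈ Ideal.span {X j ^ (s - n)} * hasseSpan n (chartTransform s j G) := hgen hx
  rw [Ideal.mem_span_singleton_mul] at hxJ
  obtain ⟨y, hy, hxy⟩ := hxJ
  have hordx : ((s - n : ℕ) : ℕ∞) ≤ ordZero x := by
    rw [natCast_le_ordZero_iff_mem_idealOfVars_pow]
    exact hasseSpan_le_idealOfVars_pow hG n hx
  rw [← X_pow_mul_chartTransform' j hordx] at hxy
  have := mul_left_cancel₀ (pow_ne_zero _ (X_ne_zero j)) hxy
  rw [← this]
  exact hy

omit [Fintype σ] in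
/-- **GIRAUD PERSISTENCE OF THE LINEAGE.**  Along an equimultiple chain `G_{n+1} = translate b_n (cT_s^{j_n} G_n)`,
`s ≤ ord₀ G_n`, ANY charts `j_n` and centres `b_n`: the lineage of an element of `hasseSpan (s−1) G_0` stays in
`hasseSpan (s−1) G_n`. [cite: Giraud1975, Lemme 4.2 p.III-29] [new: the chain form, free charts included] -/
theorem lineage_mem_hasseSpan {s : ℕ} (hs : 1 ≤ s) (G h : ℕ → MvPolynomial σ K) (j : ℕ → σ) (b : ℕ → σ → K)
    (hG : ∀ n, (s : ℕ∞) ≤ ordZero (G n))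
    (hGsucc : ∀ n, G (n + 1) = PointBlowup.translate (b n) (chartTransform s (j n) (G n)))
    (hh0 : h 0 ∈ hasseSpan (s - 1) (G 0))
    (hhsucc : ∀ n, h (n + 1) = PointBlowup.translate (b n) (chartTransform 1 (j n) (h n))) :
    ∀ n, h n ∈ hasseSpan (s - 1) (G n) := by
  intro n
  induction n with
  | zero => exact hh0
  | succ n ih =>
    rw [hhsucc n, hGsucc n]
    have h1 : s - (s - 1) = 1 := by omega
    have step := chartTransform_mem_hasseSpan (j n) (Nat.sub_le s 1) (hG n) ih
    rw [h1] at step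
    exact translate_mem_span_hasseDeriv (b n) step

omit [Fintype σ] in
/-- Elements of `hasseSpan (s−1) G` vanish at the origin (`1 ≤ s ≤ ord₀ G`). [folklore] -/
theorem one_le_ordZero_of_mem_hasseSpan {s : ℕ} (hs : 1 ≤ s) {G h : MvPolynomial σ K} (hG : (s : ℕ∞) ≤ ordZero G)
    (hh : h ∈ hasseSpan (s - 1) G) : (1 : ℕ∞) ≤ ordZero h := by
  have := hasseSpan_le_idealOfVars_pow hG (s - 1) hh
  rw [show s - (s - 1) = 1 by omega, pow_one] at this
  exact (one_le_ordZero_iff_mem_idealOfVars h).mpr this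

omit [Fintype σ] in
/-- **EVERY CENTRE LIES ON THE LINEAGE**: in the setting of `lineage_mem_hasseSpan`, the strict transform
`cT_1^{j_n} h_n` vanishes at the centre `b_n`, for every `n`. [new] -/
theorem centre_on_lineage {s : ℕ} (hs : 1 ≤ s) (G h : ℕ → MvPolynomial σ K) (j : ℕ → σ) (b : ℕ → σ → K)
    (hG : ∀ n, (s : ℕ∞) ≤ ordZero (G n))
    (hGsucc : ∀ n, G (n + 1) = PointBlowup.translate (b n) (chartTransform s (j n) (G n)))
    (hh0 : h 0 ∈ hasseSpan (s - 1) (G 0))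
    (hhsucc : ∀ n, h (n + 1) = PointBlowup.translate (b n) (chartTransform 1 (j n) (h n))) (n : ℕ) :
    eval (b n) (chartTransform 1 (j n) (h n)) = 0 := by
  have hmem := lineage_mem_hasseSpan hs G h j b hG hGsucc hh0 hhsucc (n + 1)
  have h1 := one_le_ordZero_of_mem_hasseSpan hs (hG (n + 1)) hmem
  rw [one_le_ordZero_iff, hhsucc n, Rescue.ToricGuard.constantCoeff_translate] at h1
  exact h1

omit [Fintype σ] in
/-- **TRANSVERSAL LINEAR COEFFICIENTS PERSIST**: for `i ≠ j`, `b_j = 0`, `h ∈ 𝔪`: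
`coeff_{e_i} (translate b (cT_1^j h)) = coeff_{e_i} h`. [new] -/
theorem coeff_single_translate_chartTransform_one {i j : σ} (hij : i ≠ j) {b : σ → K} (hbj : b j = 0)
    {h : MvPolynomial σ K} (hh : (1 : ℕ∞) ≤ ordZero h) :
    coeff (Finsupp.single i 1) (PointBlowup.translate b (chartTransform 1 j h)) = coeff (Finsupp.single i 1) h := by
  have hMj : (Finsupp.single i 1 : σ →₀ ℕ) j = 0 := by rw [Finsupp.single_apply, if_neg hij]
  have hdeg : (Finsupp.single i 1 : σ →₀ ℕ).degree = 1 := by simp [Finsupp.degree_single]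
  rw [← constantCoeff_hasseDeriv, hasseDeriv_translate, Rescue.ToricGuard.constantCoeff_translate,
    hasseDeriv_chartTransform_of_apply_eq_zero j hMj (by rw [hdeg]) hh, hdeg, Nat.sub_self,
    ← Rescue.ToricGuard.constantCoeff_translate, NearCut.constantCoeff_translate_chartTransform_zero j b hbj,
    constantCoeff_hasseDeriv]

omit [Fintype σ] in
/-- `chartTransform_neg`: WallFrames (lens-5 g35) computation rule; docstring added by the writer (lint.docstring) [folklore] -/
theorem chartTransform_neg (q : ℕ) (j : σ) (F : MvPolynomial σ K) : chartTransform q j (-F) = -chartTransform q j F := by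
  have h := chartTransform_add q j (-F) F
  rw [neg_add_cancel] at h
  have h0 : chartTransform q j (0 : MvPolynomial σ K) = 0 := by
    unfold PointBlowup.chartTransform; rw [MvPolynomial.support_zero, Finset.sum_empty]
  rw [h0] at h
  exact eq_neg_of_add_eq_zero_left h.symm

omit [Fintype σ] in
/-- `chartTransform_sub`: WallFrames (lens-5 g35) computation rule; docstring added by the writer (lint.docstring) [folklore] -/
theorem chartTransform_sub (q : ℕ) (j : σ) (F G : MvPolynomial σ K) :
    chartTransform q j (F - G) = chartTransform q j F - chartTransform q j G := by
  rw [sub_eq_add_neg, chartTransform_add, chartTransform_neg, ← sub_eq_add_neg]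

omit [Fintype σ] in
/-- `cT_q` of a `q`-deep polynomial vanishes on the exceptional divisor `y_j = 0` to order `ord − q`; in particular it
vanishes at every `b` with `b_j = 0` when `q < ord`. [folklore] -/
theorem eval_chartTransform_eq_zero_of_lt {q : ℕ} (j : σ) {b : σ → K} (hbj : b j = 0) {R : MvPolynomial σ K}
    (hR : ((q + 1 : ℕ) : ℕ∞) ≤ ordZero R) : eval b (chartTransform q j R) = 0 := by
  rw [chartTransform_eq_X_pow_mul_chartTransform j (Nat.le_succ q) hR, map_mul, map_pow, eval_X, hbj,
    zero_pow (by omega), zero_mul]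

omit [Fintype σ] [DecidableEq σ] in
/-- A `z`-free polynomial evaluated at a point of the `y_z`-axis gives its constant term. [folklore] -/
theorem eval_eq_constantCoeff_of_varFree {z : σ} {b : σ → K} (hb : ∀ i, i ≠ z → b i = 0) {P : MvPolynomial σ K}
    (hP : (∀ μ ∈ P.support, μ z = 0)) : eval b P = constantCoeff P := by
  rw [← Rescue.ToricGuard.constantCoeff_translate, NearCut.translate_eq_aeval,
    aeval_eq_self_of_varFree (fun i hi => by rw [hb i hi, C_0, add_zero]) hP]

/-! ## §6 The directrix reading of a near centre -/

omit [Fintype σ] in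
/-- The chart transform at its own level of a FORM is its dehomogenisation. [folklore] -/
theorem chartTransform_eq_dehom_of_isHomogeneous (j : σ) {H : MvPolynomial σ K} {s : ℕ} (hH : H.IsHomogeneous s) :
    chartTransform s j H = NearCut.dehom j H := by
  classical
  conv_rhs => rw [H.as_sum]
  unfold PointBlowup.chartTransform NearCut.dehom
  rw [map_sum]
  refine Finset.sum_congr rfl fun d hd => ?_
  rw [show aeval (Function.update X j 1) (monomial d (coeff d H)) = NearCut.dehom j (monomial d (coeff d H)) from rfl,
    NearCut.dehom_monomial]
  have he : chartExponent s j d = d.update j 0 := by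
    ext i
    rw [chartExponent_apply, Finsupp.update_apply]
    split_ifs with h
    · rw [NearCut.degree_eq_of_mem_support_of_isHomogeneous hH hd, Nat.sub_self]
    · rfl
  rw [he]

omit [Fintype σ] in
/-- Evaluating the dehomogenisation: `(H|_{y_j := 1})(b) = H(b[j ↦ 1])`. [folklore] -/
theorem eval_dehom (j : σ) (b : σ → K) (H : MvPolynomial σ K) :
    eval b (NearCut.dehom j H) = eval (Function.update b j 1) H := by
  unfold NearCut.dehom
  rw [NearCut.eval_aeval']
  have hfun : (fun i => eval b (Function.update (X : σ → MvPolynomial σ K) j 1 i)) = Function.update b j 1 := by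
    funext i
    by_cases h : i = j
    · subst h; rw [Function.update_self, Function.update_self, map_one]
    · rw [Function.update_of_ne h, Function.update_of_ne h, eval_X]
  rw [hfun]

end Lineage

end Summit.ResolutionOfSingularities.ResolutionOfSingularities.Theorems.WallFrames
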